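import Summits.AnomalousDissipation.AnomalousDissipation.Theorems.SolenoidalFractalHomogenisationLagrangianStepFrameModulationInputs
import Summits.AnomalousDissipation.AnomalousDissipation.Theorems.SolenoidalFractalHomogenisationLagrangianStepClosedWindow
import Literature.Analysis.ODE.TorusFlowFrameInverse

/-!
# K1L_D (stmt-AnomalousDissipation-27980), `stub_Z7_alphaBetaR` α-part (R3): `isModulation_frameG_closed` — the exact-flow frame is a
# modulation on the CLOSED refresh piece `[jR, t]`, `t − jR ≤ refresh (m+1)` (helper, `--supports 27980 --as helper`; prover ad-k1loc-p3 g9)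

`FrameForm.isModulation_frameG` (p698635, prover ad-k1loc-p3 g8) and its assembler `FrameForm.isModulation_frameG_of` (p695470) are stated for
a piece end `t ∈ window (m+1) j`, i.e. `t − jR < refresh (m+1)` STRICT.  The α-part of `stub_Z7_alphaBetaR` runs (α₁) on the FULL piece
`[jR, (j+1)R]` and (α₂) on `[(j+1)R, s′]` with `s′ ≤ (j+2)R` (lead-k1l-onelevel-p1 g5, 06:40Z list, item (R3)), so the CLOSED endpoint is needed.
lead g5's `…ClosedWindow` (p700875) supplies the closed-window frame facts (`window_disp_clauses_closed`, `det_frameJac_eq_one_closed`,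
`frameG_eq_adjugate_closed`, `isSmooth_frameG_entry_closed`, `isDivFree_frameG_col_closed`); this file re-runs the three steps on `T ≤ refresh (m+1)`:
* §1 the frame equation on the closed window: `hasDerivWithinAt_adjugate_frameJac_entry_closed` (generic `TorusFlow.hasDerivWithinAt_adjugate_flowJac_entry`
  fed with the closed clauses), `norm_deriv_adjugate_le_closed` (rate `≤ 3(1+θ)·Cb`);
* §2 the strain near-identity up to the endpoint: `abs_frameG_sub_one_le_strain_closed` — the half-open bound `|frameG − 1| ≤ 5C·S_m·(t − jR)`
  (`abs_frameG_sub_one_le_strain`, p696381) extended to `t = (j+1)R` by CONTINUITY in the window time of the adjugate entries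
  (`continuousOn_adjugate_frameJac_entry_closed`, Landau FR2 with the closed clauses) — `ContinuousWithinAt.closure_le`;
* §3 `isModulation_frameG_of_closed` (= `isModulation_frameG_of` with `t − jR ≤ refresh (m+1)`);
* §4 **`isModulation_frameG_closed`** (= `isModulation_frameG` with `jR < t ≤ (j+1)R`; the sharp curvature bound `hcurv` (K8-5) stays THE hypothesis,
  now on the closed `Icc 0 (t − jR)`).
NOT a proof of the stub, of K1L_D, or of AD; rung F-D1.A0.
-/

set_option linter.dupNamespace false

noncomputable section

namespace Summit.AnomalousDissipation.AnomalousDissipation.Theorems.SolenoidalFractalHomogenisation.LagrangianStep.FrameForm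

open Set Function Filter MeasureTheory Topology
open scoped NNReal
open Literature.Analysis Literature.Analysis.ODE Literature.Analysis.ODE.TorusFlow Literature.Analysis.FunctionSpaces
open Literature.Analysis.FunctionSpaces.Torus
open Literature.Analysis.FluidPDE Literature.Analysis.FluidPDE.LatticeShear
open Summit.AnomalousDissipation.AnomalousDissipation.Theorems.SolenoidalFractalHomogenisation.LagrangianCarrierConstruction
open Summit.AnomalousDissipation.AnomalousDissipation.Theorems.SolenoidalFractalHomogenisation.LagrangianCarrier

variable {k : ℕ}

/-! ## §1 The frame equation on the CLOSED window -/

/-- **The frame equation on the closed window**: for `0 < T ≤ refresh (m+1)` and `u ∈ Icc 0 T`, every entry of `u ↦ adj (frameJac)(jR+u, jR, y)`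
has, within `[0, T]`, the derivative `−(adj J · (∇b_{≤m} ∘ X)) i l` (generic `TorusFlow.hasDerivWithinAt_adjugate_flowJac_entry` with the
closed-window displacement clauses of `FrameConj.window_disp_clauses_closed`). -/
theorem hasDerivWithinAt_adjugate_frameJac_entry_closed (E : LagrangianLatticeCarrier k) (hR : E.LevelRegular) {m : ℕ} (hF : E.IsFlow m)
    (j : ℤ) {T : ℝ} (hT : T ≤ E.refresh (m + 1)) (hT0 : 0 < T) {u : ℝ} (hu : u ∈ Icc 0 T) (y : UnitAddTorus (Fin 3)) (i l : Fin 3) :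
    HasDerivWithinAt
      (fun u => (frameJac E m ((j : ℝ) * E.refresh (m + 1) + u) ((j : ℝ) * E.refresh (m + 1)) y).adjugate i l)
      (-(((frameJac E m ((j : ℝ) * E.refresh (m + 1) + u) ((j : ℝ) * E.refresh (m + 1)) y).adjugate *
        (Matrix.of fun a q => Torus.partialDeriv q (fun z => E.partialSum m ((j : ℝ) * E.refresh (m + 1) + u) z a)
          (E.X m ((j : ℝ) * E.refresh (m + 1) + u) ((j : ℝ) * E.refresh (m + 1)) y))) i l)) (Icc 0 T) u := by
  obtain ⟨hbc, hbs, hbB, hdiv⟩ := hR.window_b_clauses m ((j : ℝ) * E.refresh (m + 1)) T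
  obtain ⟨hDc, hDs, hDB⟩ := FrameConj.window_disp_clauses_closed E hR m j hT
  have h := hasDerivWithinAt_adjugate_flowJac_entry hT0 hbc hbs hbB hDc hDs hDB (fun s _ x => hF.window_integral_eq _ s x) hdiv hu y i l
  have e : ∀ u', frameJac E m ((j : ℝ) * E.refresh (m + 1) + u') ((j : ℝ) * E.refresh (m + 1)) y =
      Matrix.of fun a c => (1 : Matrix (Fin 3) (Fin 3) ℝ) a c +
        Torus.partialDeriv c (fun z => E.disp m ((j : ℝ) * E.refresh (m + 1) + u') ((j : ℝ) * E.refresh (m + 1)) z a) y := by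
    intro u'
    ext a c
    rw [frameJac, Matrix.of_apply, Matrix.of_apply, hR.flowDeriv_single_apply]
  simp_rw [e]
  exact h

/-- **Rate bound from the frame equation, closed window**: with `|G − 1| ≤ θ` entrywise and `|∂_l b_{≤m,q}(jR+u, X(u,y))| ≤ Cb` on `Icc 0 T`,
`T ≤ refresh (m+1)`, every entry of `u ↦ adj (frameJac)(u, y)` has derivative within `[0, T]` of size `≤ 3(1+θ)·Cb`. -/
theorem norm_deriv_adjugate_le_closed (E : LagrangianLatticeCarrier k) (hR : E.LevelRegular) {m : ℕ} (hF : E.IsFlow m) (j : ℤ) {T : ℝ}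
    (hT : T ≤ E.refresh (m + 1)) (hT0 : 0 < T) {θ Cb : ℝ} (hθ : 0 ≤ θ)
    (hnear : ∀ u ∈ Icc 0 T, ∀ (y : UnitAddTorus (Fin 3)) (i l : Fin 3),
      |frameG E m ((j : ℝ) * E.refresh (m + 1) + u) ((j : ℝ) * E.refresh (m + 1)) y i l - (1 : Matrix (Fin 3) (Fin 3) ℝ) i l| ≤ θ)
    (hrate : ∀ u ∈ Icc 0 T, ∀ (y : UnitAddTorus (Fin 3)) (a q : Fin 3),
      |Torus.partialDeriv q (fun z => E.partialSum m ((j : ℝ) * E.refresh (m + 1) + u) z a)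
        (E.X m ((j : ℝ) * E.refresh (m + 1) + u) ((j : ℝ) * E.refresh (m + 1)) y)| ≤ Cb)
    {u : ℝ} (hu : u ∈ Icc 0 T) (y : UnitAddTorus (Fin 3)) (i l : Fin 3) :
    ∃ D : ℝ, HasDerivWithinAt
        (fun u => (frameJac E m ((j : ℝ) * E.refresh (m + 1) + u) ((j : ℝ) * E.refresh (m + 1)) y).adjugate i l) D (Icc 0 T) u ∧
      ‖D‖ ≤ 3 * (1 + θ) * Cb := by
  refine ⟨_, hasDerivWithinAt_adjugate_frameJac_entry_closed E hR hF j hT hT0 hu y i l, ?_⟩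
  rw [norm_neg, Matrix.mul_apply, Real.norm_eq_abs]
  have hG : ∀ q, |(frameJac E m ((j : ℝ) * E.refresh (m + 1) + u) ((j : ℝ) * E.refresh (m + 1)) y).adjugate i q| ≤ 1 + θ := by
    intro q
    have h1 := hnear u hu y i q
    rw [FrameConj.frameG_eq_adjugate_closed E hR hF j hT hu y] at h1
    have hδ : |(1 : Matrix (Fin 3) (Fin 3) ℝ) i q| ≤ 1 := by
      rw [Matrix.one_apply]; split_ifs <;> simp
    calc |(frameJac E m _ _ y).adjugate i q|
        = |((frameJac E m _ _ y).adjugate i q - (1 : Matrix (Fin 3) (Fin 3) ℝ) i q) + (1 : Matrix (Fin 3) (Fin 3) ℝ) i q| := by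
          rw [sub_add_cancel]
      _ ≤ |(frameJac E m _ _ y).adjugate i q - (1 : Matrix (Fin 3) (Fin 3) ℝ) i q| + |(1 : Matrix (Fin 3) (Fin 3) ℝ) i q| :=
          abs_add_le _ _
      _ ≤ θ + 1 := add_le_add h1 hδ
      _ = 1 + θ := add_comm _ _
  have hB : ∀ q, |(Matrix.of fun a q => Torus.partialDeriv q (fun z => E.partialSum m ((j : ℝ) * E.refresh (m + 1) + u) z a)
      (E.X m ((j : ℝ) * E.refresh (m + 1) + u) ((j : ℝ) * E.refresh (m + 1)) y)) q l| ≤ Cb := fun q => by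
    rw [Matrix.of_apply]; exact hrate u hu y q l
  calc |∑ q, (frameJac E m ((j : ℝ) * E.refresh (m + 1) + u) ((j : ℝ) * E.refresh (m + 1)) y).adjugate i q *
          (Matrix.of fun a q => Torus.partialDeriv q (fun z => E.partialSum m ((j : ℝ) * E.refresh (m + 1) + u) z a)
            (E.X m ((j : ℝ) * E.refresh (m + 1) + u) ((j : ℝ) * E.refresh (m + 1)) y)) q l|
      ≤ ∑ q, |(frameJac E m ((j : ℝ) * E.refresh (m + 1) + u) ((j : ℝ) * E.refresh (m + 1)) y).adjugate i q *
          (Matrix.of fun a q => Torus.partialDeriv q (fun z => E.partialSum m ((j : ℝ) * E.refresh (m + 1) + u) z a)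
            (E.X m ((j : ℝ) * E.refresh (m + 1) + u) ((j : ℝ) * E.refresh (m + 1)) y)) q l| := Finset.abs_sum_le_sum_abs _ _
    _ ≤ ∑ _q : Fin 3, (1 + θ) * Cb := Finset.sum_le_sum fun q _ => by
          rw [abs_mul]
          exact mul_le_mul (hG q) (hB q) (abs_nonneg _) (by linarith)
    _ = 3 * (1 + θ) * Cb := by simp [Finset.sum_const]; ring

/-! ## §2 The strain near-identity of `frameG` up to the CLOSED endpoint -/

/-- The Jacobian entries `u ↦ frameJac E m (jR+u) (jR) y a c` are continuous on the CLOSED window `[0, T]`, `T ≤ refresh (m+1)`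
(Landau FR2 `TorusFlow.continuousOn_stLift_iterPartialDeriv_flowJac_entry`, word `[]`, with the closed clauses). -/
theorem continuousOn_frameJac_entry_closed (E : LagrangianLatticeCarrier k) (hR : E.LevelRegular) (m : ℕ) (j : ℤ) {T : ℝ}
    (hT : T ≤ E.refresh (m + 1)) (y : UnitAddTorus (Fin 3)) (a c : Fin 3) :
    ContinuousOn (fun u => frameJac E m ((j : ℝ) * E.refresh (m + 1) + u) ((j : ℝ) * E.refresh (m + 1)) y a c) (Icc 0 T) := by
  obtain ⟨hDc, hDs, hDB⟩ := FrameConj.window_disp_clauses_closed E hR m j hT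
  have h := continuousOn_stLift_iterPartialDeriv_flowJac_entry hDc hDs hDB a c []
  have h2 := h.comp (continuousOn_id.prodMk continuousOn_const) (fun u hu => mk_mem_prod hu (mem_univ (repr y)))
  refine h2.congr fun u _ => ?_
  rw [comp_apply, id_eq, stLift_apply, iterPartialDeriv_nil, proj_repr, frameJac, Matrix.of_apply, hR.flowDeriv_single_apply]

/-- The adjugate entries `u ↦ adj (frameJac E m (jR+u) (jR) y) i l` are continuous on the closed window. -/
theorem continuousOn_adjugate_frameJac_entry_closed (E : LagrangianLatticeCarrier k) (hR : E.LevelRegular) (m : ℕ) (j : ℤ) {T : ℝ}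
    (hT : T ≤ E.refresh (m + 1)) (y : UnitAddTorus (Fin 3)) (i l : Fin 3) :
    ContinuousOn (fun u => (frameJac E m ((j : ℝ) * E.refresh (m + 1) + u) ((j : ℝ) * E.refresh (m + 1)) y).adjugate i l) (Icc 0 T) := by
  have hJ : ContinuousOn (fun u => frameJac E m ((j : ℝ) * E.refresh (m + 1) + u) ((j : ℝ) * E.refresh (m + 1)) y) (Icc 0 T) := by
    rw [continuousOn_iff_continuous_restrict]
    refine continuous_matrix fun a c => ?_
    exact (continuousOn_iff_continuous_restrict.1 (continuousOn_frameJac_entry_closed E hR m j hT y a c))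
  rw [continuousOn_iff_continuous_restrict] at hJ ⊢
  exact (hJ.matrix_adjugate).matrix_elem i l

/-- **Strain near-identity of the inverse frame up to the CLOSED endpoint.**  With the `θs, C` of `abs_frameG_sub_one_le_strain`: for every
`LPermissible`, `Regular` carrier of design `W` (growth `N_m² ≤ N_{m+1}`, template (T4) at `θ₀ ≤ θs`), every level `m`, window index `j` and
`jR ≤ t ≤ (j+1)R`: `|frameG E m t (jR) y i l − δ_il| ≤ 5·C·(Σ_{i<m} a (i+1))·(t − jR)` (endpoint by continuity). -/
theorem abs_frameG_sub_one_le_strain_closed (k : ℕ) (W : LatticeWord k) : ∃ θs : ℝ, 0 < θs ∧ ∃ C : ℝ, 0 ≤ C ∧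
    ∀ (E : LagrangianLatticeCarrier k) (θ₀ : ℝ), E.design = W → θ₀ ≤ θs → E.LPermissible → E.Regular →
      (∀ m, E.N m ^ 2 ≤ E.N (m + 1)) → (∀ m, E.θ (m + 1) * ((E.N (m + 1) : ℝ) / E.N m) ^ (1 / 16 : ℝ) ≤ θ₀) →
      ∀ (m : ℕ) (j : ℤ) (t : ℝ), (j : ℝ) * E.refresh (m + 1) ≤ t → t ≤ ((j : ℝ) + 1) * E.refresh (m + 1) →
        ∀ (y : UnitAddTorus (Fin 3)) (i l : Fin 3),
        |frameG E m t ((j : ℝ) * E.refresh (m + 1)) y i l - (1 : Matrix (Fin 3) (Fin 3) ℝ) i l| ≤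
          5 * C * ((∑ i ∈ Finset.range m, E.a (i + 1)) * (t - (j : ℝ) * E.refresh (m + 1))) := by
  obtain ⟨θs, hθs, C, hC, H⟩ := abs_frameG_sub_one_le_strain k W
  refine ⟨θs, hθs, C, hC, fun E θ₀ hD hθ hLP hReg hsq hT4 m j t hjt htR y i l => ?_⟩
  rcases htR.lt_or_eq with hlt | heq
  · exact H E θ₀ hD hθ hLP hReg hsq hT4 m j t ⟨hjt, hlt⟩ y i l
  · -- the endpoint `t = (j+1)R`: pass to the limit `u ↑ R` in the window-time variable
    have hLR := hReg.levelRegular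
    have hF : E.IsFlow m := (hLP.isLagrangian m).1
    have hR0 : 0 < E.refresh (m + 1) := E.refresh_pos (m + 1)
    have htR' : t = (j : ℝ) * E.refresh (m + 1) + E.refresh (m + 1) := by rw [heq]; ring
    -- the two sides as functions of the window time on `[0, R]`
    have hf : ContinuousWithinAt (fun u => |(frameJac E m ((j : ℝ) * E.refresh (m + 1) + u) ((j : ℝ) * E.refresh (m + 1)) y).adjugate i l
        - (1 : Matrix (Fin 3) (Fin 3) ℝ) i l|) (Ico 0 (E.refresh (m + 1))) (E.refresh (m + 1)) := by
      have hc := continuousOn_adjugate_frameJac_entry_closed E hLR m j (le_refl (E.refresh (m + 1))) y i l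
      exact ((hc _ ⟨hR0.le, le_rfl⟩).sub continuousWithinAt_const).abs.mono Ico_subset_Icc_self
    have hg : ContinuousWithinAt (fun u => 5 * C * ((∑ i ∈ Finset.range m, E.a (i + 1)) * u)) (Ico 0 (E.refresh (m + 1)))
        (E.refresh (m + 1)) :=
      ((continuous_const.mul (continuous_const.mul continuous_id)).continuousAt).continuousWithinAt
    have hle : ∀ u ∈ Ico (0 : ℝ) (E.refresh (m + 1)),
        |(frameJac E m ((j : ℝ) * E.refresh (m + 1) + u) ((j : ℝ) * E.refresh (m + 1)) y).adjugate i l - (1 : Matrix (Fin 3) (Fin 3) ℝ) i l|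
          ≤ 5 * C * ((∑ i ∈ Finset.range m, E.a (i + 1)) * u) := by
      intro u hu
      have hwin : (j : ℝ) * E.refresh (m + 1) + u ∈ E.window (m + 1) j :=
        ⟨by linarith [hu.1], by nlinarith [hu.2]⟩
      have h := H E θ₀ hD hθ hLP hReg hsq hT4 m j ((j : ℝ) * E.refresh (m + 1) + u) hwin y i l
      rw [FrameConj.frameG_eq_adjugate_closed E hLR hF j (le_refl (E.refresh (m + 1))) (Ico_subset_Icc_self hu) y,
        add_sub_cancel_left] at h
      exact h
    have hmem : E.refresh (m + 1) ∈ closure (Ico (0 : ℝ) (E.refresh (m + 1))) := by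
      rw [closure_Ico hR0.ne]; exact ⟨hR0.le, le_rfl⟩
    have hlim := ContinuousWithinAt.closure_le hmem hf hg hle
    rw [htR', FrameConj.frameG_eq_adjugate_closed E hLR hF j (le_refl (E.refresh (m + 1))) ⟨hR0.le, le_rfl⟩ y, add_sub_cancel_left]
    exact hlim

/-! ## §3 The modulation structure from window inputs, CLOSED piece -/

/-- **`isModulation_frameG_of` on the closed piece** (`t − jR ≤ refresh (m+1)`): same inputs `hnear`, `hrate`, `hbudget`, `hpiola`, `hcurv` on
`Icc 0 (t − jR)`, same conclusion `CellClauseMod.IsModulation θ (a (m+1)·(t − jR)) nC (τ y ↦ frameG E m (jR + τ/a) (jR) y)`. -/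
theorem isModulation_frameG_of_closed (E : LagrangianLatticeCarrier k) (hR : E.LevelRegular) {m : ℕ} (hF : E.IsFlow m) (j : ℤ)
    {t : ℝ} (hst : (j : ℝ) * E.refresh (m + 1) < t) (htR : t - (j : ℝ) * E.refresh (m + 1) ≤ E.refresh (m + 1))
    {θ nC Cb : ℝ} (hθ : 0 ≤ θ) (hCb : 0 ≤ Cb)
    (hnear : ∀ u ∈ Icc 0 (t - (j : ℝ) * E.refresh (m + 1)), ∀ (y : UnitAddTorus (Fin 3)) (i l : Fin 3),
      |frameG E m ((j : ℝ) * E.refresh (m + 1) + u) ((j : ℝ) * E.refresh (m + 1)) y i l - (1 : Matrix (Fin 3) (Fin 3) ℝ) i l| ≤ θ)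
    (hrate : ∀ u ∈ Icc 0 (t - (j : ℝ) * E.refresh (m + 1)), ∀ (y : UnitAddTorus (Fin 3)) (a q : Fin 3),
      |Torus.partialDeriv q (fun z => E.partialSum m ((j : ℝ) * E.refresh (m + 1) + u) z a)
        (E.X m ((j : ℝ) * E.refresh (m + 1) + u) ((j : ℝ) * E.refresh (m + 1)) y)| ≤ Cb)
    (hbudget : 3 * (1 + θ) * Cb * (t - (j : ℝ) * E.refresh (m + 1)) ≤ θ)
    (hpiola : ∀ u ∈ Icc 0 (t - (j : ℝ) * E.refresh (m + 1)), ∀ i : Fin 3,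
      Torus.IsDivFree (fun y => (WithLp.toLp 2 fun c => frameG E m ((j : ℝ) * E.refresh (m + 1) + u) ((j : ℝ) * E.refresh (m + 1)) y c i :
        EuclideanSpace ℝ (Fin 3))))
    (hcurv : ∀ u ∈ Icc 0 (t - (j : ℝ) * E.refresh (m + 1)), ∀ (y : UnitAddTorus (Fin 3)) (i l c : Fin 3),
      |Torus.partialDeriv c (fun y => frameG E m ((j : ℝ) * E.refresh (m + 1) + u) ((j : ℝ) * E.refresh (m + 1)) y i l) y| ≤ θ * nC) :
    CellClauseMod.IsModulation θ (E.a (m + 1) * (t - (j : ℝ) * E.refresh (m + 1))) nC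
      (fun τ y => frameG E m ((j : ℝ) * E.refresh (m + 1) + τ / E.a (m + 1)) ((j : ℝ) * E.refresh (m + 1)) y) := by
  set s : ℝ := (j : ℝ) * E.refresh (m + 1) with hs
  set T : ℝ := t - s with hTdef
  set a : ℝ := E.a (m + 1) with ha
  have ha0 : 0 < a := E.toFractalCarrierData.a_pos (m + 1)
  have hT0 : 0 < T := by rw [hTdef]; linarith
  have hTR : T ≤ E.refresh (m + 1) := htR
  -- cell time ↦ window time
  have hmem : ∀ τ ∈ Icc 0 (a * T), τ / a ∈ Icc 0 T := by
    intro τ hτ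
    refine ⟨div_nonneg hτ.1 ha0.le, ?_⟩
    rw [div_le_iff₀ ha0]; linarith [hτ.2, mul_comm a T]
  -- the uniform rate bound on the window, and its two consequences
  set C : ℝ := 3 * (1 + θ) * Cb with hC
  have hC0 : 0 ≤ C := by rw [hC]; positivity
  have hderiv : ∀ (y : UnitAddTorus (Fin 3)) (i l : Fin 3), ∀ u ∈ Icc 0 T, ∃ D : ℝ, HasDerivWithinAt
      (fun u => (frameJac E m (s + u) s y).adjugate i l) D (Icc 0 T) u ∧ ‖D‖ ≤ C :=
    fun y i l u hu => norm_deriv_adjugate_le_closed E hR hF j hTR hT0 hθ hnear hrate hu y i l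
  -- mean value: the adjugate entries are `C`-Lipschitz in window time
  have hMV : ∀ (y : UnitAddTorus (Fin 3)) (i l : Fin 3), ∀ u₁ ∈ Icc 0 T, ∀ u₂ ∈ Icc 0 T,
      |(frameJac E m (s + u₂) s y).adjugate i l - (frameJac E m (s + u₁) s y).adjugate i l| ≤ C * |u₂ - u₁| := by
    intro y i l u₁ hu₁ u₂ hu₂
    choose D hD using hderiv y i l
    have h := Convex.norm_image_sub_le_of_norm_hasDerivWithin_le (f := fun u => (frameJac E m (s + u) s y).adjugate i l)
      (f' := fun u => if hu : u ∈ Icc 0 T then D u hu else 0) (s := Icc 0 T) (C := C)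
      (fun u hu => by simpa only [dif_pos hu] using (hD u hu).1)
      (fun u hu => by simpa only [dif_pos hu] using (hD u hu).2) (convex_Icc 0 T) hu₁ hu₂
    simpa only [Real.norm_eq_abs] using h
  -- `G τ` in terms of the adjugate, on the cell-time window
  have hGadj : ∀ τ ∈ Icc 0 (a * T), ∀ (y : UnitAddTorus (Fin 3)) (i l : Fin 3),
      frameG E m (s + τ / a) s y i l = (frameJac E m (s + τ / a) s y).adjugate i l := by
    intro τ hτ y i l
    rw [FrameConj.frameG_eq_adjugate_closed E hR hF j hTR (hmem τ hτ) y]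
  refine ⟨?_, ?_, ?_, ?_, ?_, ?_, ?_, ?_⟩
  · -- init
    intro y
    show frameG E m (s + 0 / a) s y = 1
    rw [zero_div, add_zero]
    exact frameG_self E hF s y
  · -- near_one
    intro τ hτ y i l
    exact hnear (τ / a) (hmem τ hτ) y i l
  · -- det_one
    intro τ hτ y
    exact FrameConj.det_frameG_eq_one_closed E hR hF j hTR (hmem τ hτ) y
  · -- piola
    intro τ hτ i
    exact hpiola (τ / a) (hmem τ hτ) i
  · -- smooth
    intro τ hτ i l
    exact FrameConj.isSmooth_frameG_entry_closed E hR hF j hTR (hmem τ hτ) i l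
  · -- grad_le
    intro τ hτ y i l c
    exact hcurv (τ / a) (hmem τ hτ) y i l c
  · -- lipschitz, constant `C / a`
    refine ⟨Real.toNNReal (C / a), fun y i l => ?_⟩
    refine LipschitzOnWith.of_dist_le_mul fun τ₁ hτ₁ τ₂ hτ₂ => ?_
    rw [Real.dist_eq, Real.dist_eq, Real.coe_toNNReal _ (div_nonneg hC0 ha0.le), hGadj τ₁ hτ₁ y i l, hGadj τ₂ hτ₂ y i l]
    have h := hMV y i l (τ₂ / a) (hmem τ₂ hτ₂) (τ₁ / a) (hmem τ₁ hτ₁)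
    calc |(frameJac E m (s + τ₁ / a) s y).adjugate i l - (frameJac E m (s + τ₂ / a) s y).adjugate i l|
        ≤ C * |τ₁ / a - τ₂ / a| := h
      _ = C / a * |τ₁ - τ₂| := by
          rw [← sub_div, abs_div, abs_of_pos ha0]; ring
  · -- tvar, constant rate `C / a`, total mass `C·T ≤ θ`
    refine ⟨fun _ => C / a, fun _ => div_nonneg hC0 ha0.le, ?_, ?_, ?_⟩
    · exact (continuous_const).integrableOn_Icc
    · rw [setIntegral_const, Real.volume_real_Icc_of_le (mul_nonneg ha0.le hT0.le), sub_zero, smul_eq_mul]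
      calc a * T * (C / a) = C * T := by field_simp
        _ ≤ θ := by rw [hC, hTdef]; exact hbudget
    · intro y i l τ₁ hτ₁ τ₂ hτ₂ h12
      rw [setIntegral_const, Real.volume_real_Icc_of_le h12, smul_eq_mul,
        hGadj τ₁ hτ₁ y i l, hGadj τ₂ hτ₂ y i l]
      have h := hMV y i l (τ₁ / a) (hmem τ₁ hτ₁) (τ₂ / a) (hmem τ₂ hτ₂)
      calc |(frameJac E m (s + τ₂ / a) s y).adjugate i l - (frameJac E m (s + τ₁ / a) s y).adjugate i l|
          ≤ C * |τ₂ / a - τ₁ / a| := h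
        _ = (τ₂ - τ₁) * (C / a) := by
            rw [← sub_div, abs_div, abs_of_pos ha0, abs_of_nonneg (by linarith)]; ring

/-! ## §4 The exact-flow frame is a modulation on the CLOSED piece -/

/-- **`isModulation_frameG` on the CLOSED piece** `jR < t ≤ (j+1)R`: for every design `W` there are `θs > 0`, `Cα ≥ 0` (depending on `k, W`) such
that for every `LPermissible`, `Regular` carrier of design `W` with `N_m² ≤ N_{m+1}`, the template (T4) at `θ₀ ≤ θs`, every level `m`, window index `j`,
piece end `t` with `jR < t ≤ (j+1)R`, and every `nC`, the sharp curvature hypothesis `|∂_c (frameG)_{il}| ≤ (Cα·strain m)·nC` on `Icc 0 (t − jR)` (K8-5)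
ALONE gives `CellClauseMod.IsModulation (Cα·strain m) (a (m+1)·(t − jR)) nC (fun τ y => frameG E m (jR + τ/a (m+1)) (jR) y)`. -/
theorem isModulation_frameG_closed (k : ℕ) (W : LatticeWord k) : ∃ θs : ℝ, 0 < θs ∧ ∃ Cα : ℝ, 0 ≤ Cα ∧
    ∀ (E : LagrangianLatticeCarrier k) (θ₀ : ℝ), E.design = W → θ₀ ≤ θs → E.LPermissible → E.Regular →
      (∀ m, E.N m ^ 2 ≤ E.N (m + 1)) → (∀ m, E.θ (m + 1) * ((E.N (m + 1) : ℝ) / E.N m) ^ (1 / 16 : ℝ) ≤ θ₀) →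
      ∀ (m : ℕ) (j : ℤ) (t : ℝ), (j : ℝ) * E.refresh (m + 1) < t → t ≤ ((j : ℝ) + 1) * E.refresh (m + 1) → ∀ (nC : ℝ),
        (∀ u ∈ Icc 0 (t - (j : ℝ) * E.refresh (m + 1)), ∀ (y : UnitAddTorus (Fin 3)) (i l c : Fin 3),
          |Torus.partialDeriv c (fun y => frameG E m ((j : ℝ) * E.refresh (m + 1) + u) ((j : ℝ) * E.refresh (m + 1)) y i l) y|
            ≤ (Cα * E.strain m) * nC) →
        CellClauseMod.IsModulation (Cα * E.strain m) (E.a (m + 1) * (t - (j : ℝ) * E.refresh (m + 1))) nC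
          (fun τ y => frameG E m ((j : ℝ) * E.refresh (m + 1) + τ / E.a (m + 1)) ((j : ℝ) * E.refresh (m + 1)) y) := by
  obtain ⟨θ₁, hθ₁, C, hC, Hnear⟩ := abs_frameG_sub_one_le_strain_closed k W
  obtain ⟨θ₂, hθ₂, C', hC', Hrate⟩ := abs_partialDeriv_partialSum_le k W
  -- the constant and the ceiling (which also keeps `θ = Cα·strain m ≤ 1`)
  set Cα : ℝ := 5 * C + 6 * C' with hCα
  have hCα0 : 0 ≤ Cα := by rw [hCα]; positivity
  refine ⟨min (min θ₁ θ₂) (1 / (Cα + 1)), lt_min (lt_min hθ₁ hθ₂) (by positivity), Cα, hCα0, ?_⟩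
  intro E θ₀ hD hθs hLP hReg hsq hT4 m j t hst htR nC hcurv
  have hθs₁ : θ₀ ≤ θ₁ := hθs.trans ((min_le_left _ _).trans (min_le_left _ _))
  have hθs₂ : θ₀ ≤ θ₂ := hθs.trans ((min_le_left _ _).trans (min_le_right _ _))
  have hθs₃ : θ₀ ≤ 1 / (Cα + 1) := hθs.trans (min_le_right _ _)
  have hLR := hReg.levelRegular
  have hF : E.IsFlow m := (hLP.isLagrangian m).1
  set s : ℝ := (j : ℝ) * E.refresh (m + 1) with hs
  set S : ℝ := ∑ i ∈ Finset.range m, E.a (i + 1) with hS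
  have hS0 : 0 ≤ S := Finset.sum_nonneg fun i _ => (E.toFractalCarrierData.a_pos _).le
  have hR0 : 0 < E.refresh (m + 1) := E.refresh_pos (m + 1)
  have hTR : t - s ≤ E.refresh (m + 1) := by rw [hs]; linarith
  -- `θ = Cα·strain m ≤ 1`
  have hNpos : ∀ m, (0 : ℝ) < E.N m := fun m => by exact_mod_cast E.toFractalCarrierData.N_pos m
  have hN2 : ∀ m, 2 * E.N m ≤ E.N (m + 1) := hLP.permissible.2.2.1
  have hθm : E.θ (m + 1) ≤ θ₀ := by
    have hNmono : (E.N m : ℝ) ≤ E.N (m + 1) := by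
      have h : (2 : ℝ) * E.N m ≤ E.N (m + 1) := by exact_mod_cast hN2 m
      linarith [hNpos m]
    have hr : (1 : ℝ) ≤ ((E.N (m + 1) : ℝ) / E.N m) ^ (1 / 16 : ℝ) :=
      Real.one_le_rpow ((one_le_div (hNpos m)).2 hNmono) (by norm_num)
    calc E.θ (m + 1) = E.θ (m + 1) * 1 := (mul_one _).symm
      _ ≤ E.θ (m + 1) * ((E.N (m + 1) : ℝ) / E.N m) ^ (1 / 16 : ℝ) := mul_le_mul_of_nonneg_left hr (E.θ_pos _).le
      _ ≤ θ₀ := hT4 m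
  have hstrain_def : E.strain m = S * E.refresh (m + 1) := by
    simp [LagrangianLatticeCarrier.strain, hS]
  have hstrain0 : 0 ≤ E.strain m := by rw [hstrain_def]; exact mul_nonneg hS0 hR0.le
  have hstrainθ : E.strain m ≤ θ₀ := (hLP.strain_le m).trans hθm
  have hθle1 : Cα * E.strain m ≤ 1 := by
    have h1 : Cα * θ₀ ≤ Cα * (1 / (Cα + 1)) := mul_le_mul_of_nonneg_left hθs₃ hCα0
    have h2 : Cα * (1 / (Cα + 1)) ≤ 1 := by
      rw [mul_one_div, div_le_one (by positivity)]; linarith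
    nlinarith [mul_le_mul_of_nonneg_left hstrainθ hCα0]
  have hθ0 : 0 ≤ Cα * E.strain m := mul_nonneg hCα0 hstrain0
  -- the window strain budget on the closed piece: `S·u ≤ S·(t − s) ≤ S·R = strain m`
  have hSw : ∀ u ∈ Icc 0 (t - s), S * u ≤ E.strain m := fun u hu => by
    rw [hstrain_def]; exact mul_le_mul_of_nonneg_left (hu.2.trans hTR) hS0
  -- hnear (closed endpoint included)
  have hnear : ∀ u ∈ Icc 0 (t - s), ∀ (y : UnitAddTorus (Fin 3)) (i l : Fin 3),
      |frameG E m (s + u) s y i l - (1 : Matrix (Fin 3) (Fin 3) ℝ) i l| ≤ Cα * E.strain m := by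
    intro u hu y i l
    have h := Hnear E θ₀ hD hθs₁ hLP hReg hsq hT4 m j (s + u) (by rw [hs]; linarith [hu.1])
      (by rw [hs]; nlinarith [hu.2, hTR]) y i l
    have h5 : 5 * C * (S * (s + u - (j : ℝ) * E.refresh (m + 1))) ≤ 5 * C * E.strain m := by
      refine mul_le_mul_of_nonneg_left ?_ (by positivity)
      have e : s + u - (j : ℝ) * E.refresh (m + 1) = u := by rw [hs]; ring
      rw [e]; exact hSw u hu
    have h6 : 5 * C * E.strain m ≤ Cα * E.strain m := by
      rw [hCα]; nlinarith [mul_nonneg hC' hstrain0]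
    exact h.trans (h5.trans h6)
  -- hrate with `Cb = C'·S`, and the budget `3(1+θ)·Cb·(t−s) ≤ 6 C'·strain ≤ θ`
  have hrate : ∀ u ∈ Icc 0 (t - s), ∀ (y : UnitAddTorus (Fin 3)) (a q : Fin 3),
      |Torus.partialDeriv q (fun z => E.partialSum m (s + u) z a) (E.X m (s + u) s y)| ≤ C' * S :=
    fun u _ y a q => Hrate E θ₀ hD hθs₂ hLP hReg hsq hT4 m (s + u) _ a q
  have hbudget : 3 * (1 + Cα * E.strain m) * (C' * S) * (t - s) ≤ Cα * E.strain m := by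
    have hsw : S * (t - s) ≤ E.strain m := hSw (t - s) ⟨by linarith, le_rfl⟩
    have h1 : 3 * (1 + Cα * E.strain m) * (C' * S) * (t - s) ≤ 6 * C' * (S * (t - s)) := by
      have : (1 + Cα * E.strain m) ≤ 2 := by linarith
      have hSt : 0 ≤ S * (t - s) := mul_nonneg hS0 (by linarith)
      nlinarith [mul_nonneg hC' hSt]
    have h2 : 6 * C' * (S * (t - s)) ≤ 6 * C' * E.strain m := mul_le_mul_of_nonneg_left hsw (by positivity)
    have h3 : 6 * C' * E.strain m ≤ Cα * E.strain m := by rw [hCα]; nlinarith [mul_nonneg hC hstrain0]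
    linarith
  -- assemble
  exact isModulation_frameG_of_closed E hLR hF j hst hTR hθ0 (mul_nonneg hC' hS0) hnear hrate hbudget
    (fun u hu i => FrameConj.isDivFree_frameG_col_closed E hLR hF j hTR hu i) hcurv

end Summit.AnomalousDissipation.AnomalousDissipation.Theorems.SolenoidalFractalHomogenisation.LagrangianStep.FrameForm

end
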